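import Literature.Topology.Euclidean.BrouwerFixedPoint
import Mathlib.Topology.UrysohnsLemma
import Mathlib.Topology.Separation.Regular
import Mathlib.Topology.Connected.Clopen
import HarnessLib

/-!
# Browder's continuation theorem (the parametric Brouwer fixed point theorem)

**Theorem** (F. E. Browder 1960; in the form of Solan–Solan, Amer. Math. Monthly 130 (2023) 370,
Theorem 1.1). Let `X = [0,1]ⁿ` and `f : [0,1] × X → X` be continuous, and let
`C_f = {(t, x) | f(t, x) = x}` be its set of fixed points. Then `C_f` has a connected component
whose projection to the first coordinate is `[0, 1]`.

This is the topological statement behind "continuous curves of solutions" obtained from a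
`U`-dependent fixed-point map, e.g. Goldbaum, CMP 258 (2005) 317, §3 (continuation in the coupling
`U` of the solutions of the Lieb–Wu equations produced by Brouwer's theorem in §2; Goldbaum
sketches a fixed-point-index argument — Browder's original proof — and obtains "a connected set of
solutions"). The component need not be path connected (Solan–Solan, Example 1.2).

Main results (namespace `Literature.Topology.Euclidean.Browder`), for a finite index type `ι`, in the
coordinate form in which the parameter is one coordinate `i₀` of the box `{a ≤ x ≤ b} ⊆ ι → ℝ`
preserved by `f` (equivalent to the product form `[α, β] × box`):

* (private) `exists_fixedPoint_of_mapsTo_box` — Brouwer's theorem on a box (from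
  `Literature.Topology.Euclidean.Brouwer.exists_fixedPoint_closedBall`; the same reduction as
  `LiebWuGoldbaum.exists_fixedPoint_of_mapsTo_box`, which cannot be imported here);
* `exists_open_separation` — the point-set lemma: in a Hausdorff space, if `K` is compact,
  `A, B ⊆ K` closed, and no connected component of `K` (`connectedComponentIn K x`, `x ∈ A`) meets
  both `A` and `B`, then `K` is covered by two disjoint open sets containing `A` and `B`
  respectively (components of a compact Hausdorff space are intersections of clopen sets,
  Mathlib's `connectedComponent_eq_iInter_isClopen`);
* `exists_isConnected_fixedPoints` — **Browder's theorem**: for `f` continuous mapping the box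
  into itself with `f x i₀ = x i₀`, the fixed point set contains a connected set (indeed a connected
  component of it) whose `i₀`-projection is the whole interval `[a i₀, b i₀]`.

## Proof (Solan–Solan 2023, §2, with Proposition 2.1 replaced by `exists_open_separation`)

If no component of the (compact) fixed point set `K` meets both faces `A = K ∩ {x_{i₀} = a_{i₀}}`
and `B = K ∩ {x_{i₀} = b_{i₀}}`, separate `K ⊆ U ⊔ V` with `A ⊆ U`, `B ⊆ V` (this replaces the
box-approximation argument of Solan–Solan's Proposition 2.1). By Urysohn's lemma there is a
continuous `g` equal to `0` on `{x_{i₀} ≤ a_{i₀}} ∪ (K ∖ V)` and to `1` on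
`{b_{i₀} ≤ x_{i₀}} ∪ (K ∖ U)` (disjoint closed sets when `a_{i₀} < b_{i₀}`). The map
`F x = update (f x) i₀ (clamp (x_{i₀} + (b_{i₀} - a_{i₀})(1 - 2 g x)))` (Solan–Solan's
`(t + ε g, f)`, Proposition 2.2, with a clamp instead of a small `ε`) is a continuous self-map of
the box; a Brouwer fixed point `x⋆` of `F` is a fixed point of `f`, so `x⋆ ∈ K ⊆ U ⊔ V`; if
`x⋆ ∈ U` then `g x⋆ = 0` and the clamp forces `x⋆_{i₀} = b_{i₀}`, i.e. `x⋆ ∈ B ⊆ V`; if `x⋆ ∈ V`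
then `g x⋆ = 1` forces `x⋆ ∈ A ⊆ U` — a contradiction either way. Hence some component `C` of `K`
meets both faces, and its projection, a preconnected subset of `[a_{i₀}, b_{i₀}]` containing both
end points, is the whole interval.

Mathlib has Urysohn's lemma (`exists_continuous_zero_one_of_isClosed`), the clopen description of
components in compact Hausdorff spaces and `SeparatedNhds.of_isCompact_isCompact`, but neither
Brouwer's nor Browder's theorem (searched `Browder`, `fixedPoint` + `connected`).

## References

* F. E. Browder, *On continuity of fixed points under deformations of continuous mappings*, Summa
  Brasil. Math. 4 (1960) 183–191. [Browder1960]
* E. Solan, O. N. Solan, *Browder's theorem through Brouwer's fixed point theorem*, Amer. Math.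
  Monthly 130 (2023) 370–374 = arXiv:2107.02428 (held), Theorem 1.1, Propositions 2.1–2.2.
  [SolanSolan2023]
* P. S. Goldbaum, CMP 258 (2005) 317, §3. [Goldbaum2005]
-/

open Set Metric Topology Filter

namespace Literature.Topology.Euclidean.Browder

/-! ### Brouwer's fixed point theorem on a box -/

section Brouwer

variable {ι : Type*} [Fintype ι]

/-- The Euclidean norm of a vector with coordinates bounded by `M ≥ 0` is at most `√(card ι) · M`.
[folklore] -/
private theorem norm_le_of_forall_abs_le (x : EuclideanSpace ℝ ι) {M : ℝ} (hM : 0 ≤ M)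
    (h : ∀ i, |x i| ≤ M) : ‖x‖ ≤ Real.sqrt (Fintype.card ι) * M := by
  rw [EuclideanSpace.norm_eq]
  calc Real.sqrt (∑ i, ‖x i‖ ^ 2) ≤ Real.sqrt (∑ _i : ι, M ^ 2) := by
        gcongr with i
        rw [Real.norm_eq_abs]
        exact h i
    _ = Real.sqrt (Fintype.card ι) * M := by
        rw [Finset.sum_const, Finset.card_univ, nsmul_eq_mul, Real.sqrt_mul (Nat.cast_nonneg _),
          Real.sqrt_sq hM]

/-- **Brouwer's fixed point theorem on a box.** A continuous map of `ι → ℝ` (`ι` finite) sending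
the box `{x | a ≤ x ≤ b}` (`a ≤ b`) into itself has a fixed point in the box. Reduced to
`Literature.Topology.Euclidean.Brouwer.exists_fixedPoint_closedBall` (the closed unit ball of
`EuclideanSpace ℝ ι`) by rescaling and composing with the coordinatewise retraction
`x ↦ max a (min b x)` onto the box. (Private copy of
`LiebWuGoldbaum.exists_fixedPoint_of_mapsTo_box`, whose file cannot be imported into this topic.)
[folklore] -/
private theorem exists_fixedPoint_of_mapsTo_box {a b : ι → ℝ} (hab : a ≤ b) {f : (ι → ℝ) → (ι → ℝ)}
    (hf : Continuous f) (hmaps : ∀ x, a ≤ x → x ≤ b → a ≤ f x ∧ f x ≤ b) :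
    ∃ x, a ≤ x ∧ x ≤ b ∧ f x = x := by
  classical
  -- the retraction onto the box
  set clamp : (ι → ℝ) → (ι → ℝ) := fun x i => max (a i) (min (b i) (x i)) with hclamp
  have hclamp_cont : Continuous clamp :=
    continuous_pi fun i => continuous_const.max (continuous_const.min (continuous_apply i))
  have hclamp_mem : ∀ x, a ≤ clamp x ∧ clamp x ≤ b := fun x =>
    ⟨fun i => le_max_left _ _, fun i => max_le (hab i) (min_le_left _ _)⟩
  have hclamp_id : ∀ x, a ≤ x → x ≤ b → clamp x = x := fun x ha hb => by
    ext i
    simp [hclamp, min_eq_right (hb i), max_eq_right (ha i)]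
  -- a radius containing the box
  set M : ℝ := ∑ i, (|a i| + |b i|) with hM
  have hM0 : 0 ≤ M := Finset.sum_nonneg fun i _ => by positivity
  have hcoord : ∀ x, a ≤ x → x ≤ b → ∀ i, |x i| ≤ M := by
    intro x ha hb i
    have h1 : |x i| ≤ |a i| + |b i| := by
      rw [abs_le]
      constructor
      · have := ha i; have := neg_abs_le (a i); have := abs_nonneg (b i); linarith
      · have := hb i; have := le_abs_self (b i); have := abs_nonneg (a i); linarith
    exact h1.trans (Finset.single_le_sum (f := fun i => |a i| + |b i|)
      (fun i _ => by positivity) (Finset.mem_univ i))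
  set R : ℝ := Real.sqrt (Fintype.card ι) * M + 1 with hR
  have hR0 : 0 < R := by positivity
  have hbox_norm : ∀ x, a ≤ x → x ≤ b → ‖(WithLp.toLp 2 x : EuclideanSpace ℝ ι)‖ ≤ R := by
    intro x ha hb
    have := norm_le_of_forall_abs_le (WithLp.toLp 2 x : EuclideanSpace ℝ ι) hM0
      (fun i => by simpa using hcoord x ha hb i)
    linarith
  -- the conjugated self-map of the unit ball
  set g : EuclideanSpace ℝ ι → EuclideanSpace ℝ ι :=
    fun y => WithLp.toLp 2 (R⁻¹ • f (clamp (R • (WithLp.ofLp y)))) with hg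
  have hg_cont : Continuous g := by
    have h1 : Continuous fun y : EuclideanSpace ℝ ι => R • (WithLp.ofLp y : ι → ℝ) :=
      (PiLp.continuous_ofLp 2 (fun _ : ι => ℝ)).const_smul R
    have h2 : Continuous fun y : EuclideanSpace ℝ ι => R⁻¹ • f (clamp (R • (WithLp.ofLp y))) :=
      (hf.comp (hclamp_cont.comp h1)).const_smul R⁻¹
    exact (PiLp.continuous_toLp 2 (fun _ : ι => ℝ)).comp h2
  have hg_maps : MapsTo g (closedBall 0 1) (closedBall 0 1) := by
    intro y _
    rw [mem_closedBall_zero_iff, hg]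
    dsimp only
    obtain ⟨ha, hb⟩ := hmaps _ (hclamp_mem (R • WithLp.ofLp y)).1 (hclamp_mem (R • WithLp.ofLp y)).2
    have := hbox_norm _ ha hb
    rw [WithLp.toLp_smul, norm_smul, norm_inv, Real.norm_of_nonneg hR0.le,
      inv_mul_le_iff₀ hR0, mul_one]
    exact this
  obtain ⟨y, -, hy⟩ :=
    Literature.Topology.Euclidean.Brouwer.exists_fixedPoint_closedBall hg_cont.continuousOn hg_maps
  -- unwind
  set x : ι → ℝ := R • WithLp.ofLp y with hx
  have hfx : f (clamp x) = x := by
    have h1 : WithLp.ofLp (g y) = WithLp.ofLp y := by rw [hy]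
    rw [hg] at h1
    dsimp only at h1
    rw [WithLp.ofLp_toLp] at h1
    have h2 : R • (R⁻¹ • f (clamp (R • WithLp.ofLp y))) = R • WithLp.ofLp y := by rw [h1]
    rwa [smul_smul, mul_inv_cancel₀ hR0.ne', one_smul] at h2
  obtain ⟨ha, hb⟩ := hmaps _ (hclamp_mem x).1 (hclamp_mem x).2
  rw [hfx] at ha hb
  refine ⟨x, ha, hb, ?_⟩
  rw [hclamp_id x ha hb] at hfx
  exact hfx

end Brouwer

/-! ### Separating two closed sets not joined by a component of a compact set -/

/-- **Separation lemma.** In a Hausdorff space let `K` be compact and `A, B ⊆ K` closed, and suppose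
that no connected component of `K` through a point of `A` meets `B`. Then there are disjoint open
sets `U ⊇ A`, `V ⊇ B` covering `K`. (In the compact Hausdorff space `K` the component of `x ∈ A`
is the intersection of its clopen neighbourhoods, so by compactness of `B` one of them misses `B`;
finitely many of these cover `A`; their union `W` and `K ∖ W` are disjoint compact sets, separated
by open sets of the ambient space.) This replaces Proposition 2.1 of Solan–Solan (2023) (there
proved by box approximations of the fixed point set). [cite: SolanSolan2023, Proposition 2.1] -/
theorem exists_open_separation {X : Type*} [TopologicalSpace X] [T2Space X] {K A B : Set X}
    (hK : IsCompact K) (hA : IsClosed A) (hB : IsClosed B) (hAK : A ⊆ K) (hBK : B ⊆ K)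
    (h : ∀ x ∈ A, Disjoint (connectedComponentIn K x) B) :
    ∃ U V : Set X, IsOpen U ∧ IsOpen V ∧ Disjoint U V ∧ K ⊆ U ∪ V ∧ A ⊆ U ∧ B ⊆ V := by
  classical
  haveI : CompactSpace K := isCompact_iff_compactSpace.1 hK
  -- the traces of `A` and `B` on the subspace `K`
  set A' : Set K := ((↑) : K → X) ⁻¹' A with hA'
  set B' : Set K := ((↑) : K → X) ⁻¹' B with hB'
  have hA'c : IsClosed A' := hA.preimage continuous_subtype_val
  have hB'c : IsClosed B' := hB.preimage continuous_subtype_val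
  have hB'cpt : IsCompact B' := hB'c.isCompact
  have hA'cpt : IsCompact A' := hA'c.isCompact
  -- each point of `A'` has a clopen neighbourhood missing `B'`
  have hZ : ∀ x : K, (x : X) ∈ A → ∃ Z : Set K, IsClopen Z ∧ x ∈ Z ∧ Disjoint Z B' := by
    intro x hx
    have hcc : Disjoint (connectedComponent x) B' := by
      rw [Set.disjoint_left]
      intro y hy hyB
      have hy' : (y : X) ∈ connectedComponentIn K (x : X) := by
        rw [connectedComponentIn_eq_image x.2]
        exact ⟨y, hy, rfl⟩
      exact Set.disjoint_left.1 (h x hx) hy' hyB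
    rw [connectedComponent_eq_iInter_isClopen x, Set.disjoint_iff_inter_eq_empty,
      Set.inter_comm] at hcc
    obtain ⟨u, hu⟩ := hB'cpt.elim_finite_subfamily_closed
      (fun s : { s : Set K // IsClopen s ∧ x ∈ s } => (s : Set K)) (fun s => s.2.1.1) hcc
    refine ⟨⋂ s ∈ u, (s : Set K), isClopen_biInter_finset fun s _ => s.2.1,
      Set.mem_iInter₂.2 fun s _ => s.2.2, ?_⟩
    rw [Set.disjoint_iff_inter_eq_empty, Set.inter_comm]
    exact hu
  choose Z hZc hZx hZB using hZ
  -- finitely many of them cover `A'`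
  obtain ⟨t, ht⟩ := hA'cpt.elim_finite_subcover (fun x : { x : K // (x : X) ∈ A } => Z x.1 x.2)
    (fun x => (hZc x.1 x.2).isOpen) (fun x hx => Set.mem_iUnion.2 ⟨⟨x, hx⟩, hZx x hx⟩)
  set W : Set K := ⋃ x ∈ t, Z x.1 x.2 with hW
  have hWc : IsClopen W := isClopen_biUnion_finset fun x _ => hZc x.1 x.2
  have hAW : A' ⊆ W := ht
  have hWB : Disjoint W B' := by
    rw [hW, Set.disjoint_iUnion₂_left]
    exact fun x _ => hZB x.1 x.2
  -- push the clopen partition of `K` to the ambient space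
  have h1 : IsCompact (((↑) : K → X) '' W) := hWc.1.isCompact.image continuous_subtype_val
  have h2 : IsCompact (((↑) : K → X) '' Wᶜ) :=
    hWc.compl.1.isCompact.image continuous_subtype_val
  have h12 : Disjoint (((↑) : K → X) '' W) (((↑) : K → X) '' Wᶜ) :=
    (Set.disjoint_image_iff Subtype.val_injective).2 disjoint_compl_right
  obtain ⟨U, V, hU, hV, hWU, hWV, hUV⟩ := SeparatedNhds.of_isCompact_isCompact h1 h2 h12
  refine ⟨U, V, hU, hV, hUV, fun k hk => ?_, fun a ha => ?_, fun b hb => ?_⟩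
  · by_cases hkW : (⟨k, hk⟩ : K) ∈ W
    · exact Or.inl (hWU ⟨⟨k, hk⟩, hkW, rfl⟩)
    · exact Or.inr (hWV ⟨⟨k, hk⟩, hkW, rfl⟩)
  · exact hWU ⟨⟨a, hAK ha⟩, hAW (show (⟨a, hAK ha⟩ : K) ∈ A' from ha), rfl⟩
  · refine hWV ⟨⟨b, hBK hb⟩, ?_, rfl⟩
    intro hbW
    exact Set.disjoint_left.1 hWB hbW (show (⟨b, hBK hb⟩ : K) ∈ B' from hb)

/-! ### Browder's theorem -/

section Browder

variable {ι : Type*} [Fintype ι] [DecidableEq ι]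

/-- **Browder's continuation theorem** (parametric Brouwer fixed point theorem), coordinate form.
Let `f` be a continuous map of `ι → ℝ` (`ι` finite) sending the box `{a ≤ x ≤ b}` (`a ≤ b`) into
itself and preserving the coordinate `i₀` (the parameter: `f x i₀ = x i₀`, so that `f` is a family
of self-maps of the slices `{x_{i₀} = t}`, `t ∈ [a_{i₀}, b_{i₀}]`). Then the set of fixed points of
`f` in the box contains a connected set — a connected component of it — whose projection to the
coordinate `i₀` is the whole interval `[a_{i₀}, b_{i₀}]`. Browder (1960); Solan–Solan, Amer. Math.
Monthly 130 (2023) 370, Theorem 1.1 ("`C_f` has a connected component whose projection to the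
first coordinate is `[0, 1]`"), proved from Brouwer's theorem as there (Proposition 2.2) with
`exists_open_separation` in place of their Proposition 2.1. [cite: SolanSolan2023, Theorem 1.1]
[cite: Browder1960] -/
theorem exists_isConnected_fixedPoints {a b : ι → ℝ} (hab : a ≤ b) (i₀ : ι)
    {f : (ι → ℝ) → (ι → ℝ)} (hf : Continuous f) (hmaps : ∀ x, a ≤ x → x ≤ b → a ≤ f x ∧ f x ≤ b)
    (hpar : ∀ x, f x i₀ = x i₀) :
    ∃ C ⊆ {x | a ≤ x ∧ x ≤ b ∧ f x = x}, IsConnected C ∧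
      (fun x => x i₀) '' C = Set.Icc (a i₀) (b i₀) := by
  -- the fixed point set and its two faces
  set K : Set (ι → ℝ) := {x | a ≤ x ∧ x ≤ b ∧ f x = x} with hKdef
  have hKeq : K = Set.Icc a b ∩ {x | f x = x} := by
    ext x
    simp only [hKdef, Set.mem_setOf_eq, Set.mem_inter_iff, Set.mem_Icc, and_assoc]
  have hKc : IsClosed K := by
    rw [hKeq]
    exact isClosed_Icc.inter (isClosed_eq hf continuous_id)
  have hKcpt : IsCompact K := by
    rw [hKeq]
    exact isCompact_Icc.inter_right (isClosed_eq hf continuous_id)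
  set A : Set (ι → ℝ) := K ∩ {x | x i₀ = a i₀} with hAdef
  set B : Set (ι → ℝ) := K ∩ {x | x i₀ = b i₀} with hBdef
  have hAc : IsClosed A := hKc.inter (isClosed_eq (continuous_apply i₀) continuous_const)
  have hBc : IsClosed B := hKc.inter (isClosed_eq (continuous_apply i₀) continuous_const)
  -- Main claim: some component of `K` through `A` meets `B`.
  have hmeet : ∃ x ∈ A, (connectedComponentIn K x ∩ B).Nonempty := by
    by_contra hcon
    have hdis : ∀ x ∈ A, Disjoint (connectedComponentIn K x) B := fun x hx =>
      Set.disjoint_iff_inter_eq_empty.2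
        (Set.not_nonempty_iff_eq_empty.1 fun hne => hcon ⟨x, hx, hne⟩)
    obtain ⟨U, V, hU, hV, hUV, hKUV, hAU, hBV⟩ :=
      exists_open_separation hKcpt hAc hBc Set.inter_subset_left Set.inter_subset_left hdis
    rcases (hab i₀).lt_or_eq with hlt | heq
    · -- the Urysohn function
      set F₀ : Set (ι → ℝ) := {x | x i₀ ≤ a i₀} ∪ (K ∩ Vᶜ) with hF₀
      set F₁ : Set (ι → ℝ) := {x | b i₀ ≤ x i₀} ∪ (K ∩ Uᶜ) with hF₁
      have hF₀c : IsClosed F₀ :=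
        (isClosed_le (continuous_apply i₀) continuous_const).union (hKc.inter hV.isClosed_compl)
      have hF₁c : IsClosed F₁ :=
        (isClosed_le continuous_const (continuous_apply i₀)).union (hKc.inter hU.isClosed_compl)
      have hF₀₁ : Disjoint F₀ F₁ := by
        rw [Set.disjoint_left]
        rintro x (hx0 | ⟨hxK, hxV⟩) (hx1 | ⟨hxK', hxU⟩)
        · exact absurd (hx1.trans hx0) (not_le.2 hlt)
        · -- `x i₀ ≤ a i₀` and `x ∈ K ∖ U`: then `x ∈ A ⊆ U`
          have hxa : x i₀ = a i₀ := le_antisymm hx0 (hxK'.1 i₀)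
          exact hxU (hAU ⟨hxK', hxa⟩)
        · have hxb : x i₀ = b i₀ := le_antisymm (hxK.2.1 i₀) hx1
          exact hxV (hBV ⟨hxK, hxb⟩)
        · rcases hKUV hxK with hxU' | hxV'
          · exact hxU hxU'
          · exact hxV hxV'
      obtain ⟨g, hg0, hg1, -⟩ := exists_continuous_zero_one_of_isClosed hF₀c hF₁c hF₀₁
      -- the perturbed map
      set s : (ι → ℝ) → ℝ := fun x => (b i₀ - a i₀) * (1 - 2 * g x) with hs
      have hscont : Continuous s := continuous_const.mul (continuous_const.sub
        (continuous_const.mul g.continuous))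
      set F : (ι → ℝ) → (ι → ℝ) :=
        fun x => Function.update (f x) i₀ (max (a i₀) (min (b i₀) (x i₀ + s x))) with hFdef
      have hFcont : Continuous F :=
        hf.update i₀ (continuous_const.max (continuous_const.min
          ((continuous_apply i₀).add hscont)))
      have hFmaps : ∀ x, a ≤ x → x ≤ b → a ≤ F x ∧ F x ≤ b := by
        intro x ha hb
        obtain ⟨hfa, hfb⟩ := hmaps x ha hb
        constructor
        · intro i
          by_cases hi : i = i₀
          · subst hi
            rw [hFdef]
            dsimp only
            rw [Function.update_self]
            exact le_max_left _ _
          · rw [hFdef]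
            dsimp only
            rw [Function.update_of_ne hi]
            exact hfa i
        · intro i
          by_cases hi : i = i₀
          · subst hi
            rw [hFdef]
            dsimp only
            rw [Function.update_self]
            exact max_le (hab _) (min_le_left _ _)
          · rw [hFdef]
            dsimp only
            rw [Function.update_of_ne hi]
            exact hfb i
      obtain ⟨x, hxa, hxb, hFx⟩ := exists_fixedPoint_of_mapsTo_box hab hFcont hFmaps
      -- `x` is a fixed point of `f`
      have hfx : f x = x := by
        ext i
        by_cases hi : i = i₀
        · subst hi
          exact hpar x
        · have := congrFun hFx i
          rw [hFdef] at this
          dsimp only at this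
          rwa [Function.update_of_ne hi] at this
      have hxK : x ∈ K := ⟨hxa, hxb, hfx⟩
      have hxi₀ : x i₀ = max (a i₀) (min (b i₀) (x i₀ + s x)) := by
        have := congrFun hFx i₀
        rw [hFdef] at this
        dsimp only at this
        rw [Function.update_self] at this
        exact this.symm
      rcases hKUV hxK with hxU | hxV
      · -- `g x = 0`, the clamp forces `x i₀ = b i₀`, so `x ∈ B ⊆ V`
        have hxV : x ∉ V := fun hxV => Set.disjoint_left.1 hUV hxU hxV
        have hg : g x = 0 := hg0 (Or.inr ⟨hxK, hxV⟩)
        have hsx : s x = b i₀ - a i₀ := by rw [hs]; dsimp only; rw [hg]; ring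
        have hxb' : x i₀ = b i₀ := by
          rw [hsx] at hxi₀
          have h1 : min (b i₀) (x i₀ + (b i₀ - a i₀)) = b i₀ :=
            min_eq_left (by linarith [hxa i₀])
          rw [h1, max_eq_right (hab i₀)] at hxi₀
          exact hxi₀
        exact hxV (hBV ⟨hxK, hxb'⟩)
      · -- `g x = 1`, the clamp forces `x i₀ = a i₀`, so `x ∈ A ⊆ U`
        have hxU : x ∉ U := fun hxU => Set.disjoint_left.1 hUV hxU hxV
        have hg : g x = 1 := hg1 (Or.inr ⟨hxK, hxU⟩)
        have hsx : s x = -(b i₀ - a i₀) := by rw [hs]; dsimp only; rw [hg]; ring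
        have hxa' : x i₀ = a i₀ := by
          rw [hsx] at hxi₀
          have h1 : min (b i₀) (x i₀ + -(b i₀ - a i₀)) = x i₀ + -(b i₀ - a i₀) :=
            min_eq_right (by linarith [hxb i₀])
          rw [h1, max_eq_left (by linarith [hxb i₀])] at hxi₀
          exact hxi₀
        exact hxU (hAU ⟨hxK, hxa'⟩)
    · -- degenerate interval: any fixed point lies on both faces
      obtain ⟨x, hxa, hxb, hfx⟩ := exists_fixedPoint_of_mapsTo_box hab hf hmaps
      have hxK : x ∈ K := ⟨hxa, hxb, hfx⟩
      have hxa' : x i₀ = a i₀ := le_antisymm (by rw [heq]; exact hxb i₀) (hxa i₀)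
      have hxb' : x i₀ = b i₀ := by rw [← heq]; exact hxa'
      exact hcon ⟨x, ⟨hxK, hxa'⟩, x, mem_connectedComponentIn hxK, hxK, hxb'⟩
  -- the component through such a point does the job
  obtain ⟨x, ⟨hxK, hxa⟩, y, hyC, hyK, hyb⟩ := hmeet
  refine ⟨connectedComponentIn K x, connectedComponentIn_subset K x,
    isConnected_connectedComponentIn_iff.2 hxK, ?_⟩
  apply Set.Subset.antisymm
  · rintro _ ⟨z, hz, rfl⟩
    have hzK := connectedComponentIn_subset K x hz
    exact ⟨hzK.1 i₀, hzK.2.1 i₀⟩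
  · have hpre : IsPreconnected ((fun z : ι → ℝ => z i₀) '' connectedComponentIn K x) :=
      isPreconnected_connectedComponentIn.image _ (continuous_apply i₀).continuousOn
    have ha : a i₀ ∈ (fun z : ι → ℝ => z i₀) '' connectedComponentIn K x :=
      ⟨x, mem_connectedComponentIn hxK, hxa⟩
    have hb : b i₀ ∈ (fun z : ι → ℝ => z i₀) '' connectedComponentIn K x := ⟨y, hyC, hyb⟩
    exact hpre.Icc_subset ha hb

/-- **Browder's theorem, two-face form.** Under the hypotheses of `exists_isConnected_fixedPoints`,
the fixed point set of `f` in the box contains a connected set meeting both faces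
`{x_{i₀} = a_{i₀}}` and `{x_{i₀} = b_{i₀}}` ("a connected set of solutions extending from" one end
of the parameter interval to the other, the form used by Goldbaum, CMP 258 (2005) 317, §3).
[cite: SolanSolan2023, Theorem 1.1] [cite: Goldbaum2005, §3] -/
theorem exists_isConnected_fixedPoints_inter_faces {a b : ι → ℝ} (hab : a ≤ b) (i₀ : ι)
    {f : (ι → ℝ) → (ι → ℝ)} (hf : Continuous f) (hmaps : ∀ x, a ≤ x → x ≤ b → a ≤ f x ∧ f x ≤ b)
    (hpar : ∀ x, f x i₀ = x i₀) :
    ∃ C ⊆ {x | a ≤ x ∧ x ≤ b ∧ f x = x}, IsConnected C ∧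
      (∃ x ∈ C, x i₀ = a i₀) ∧ ∃ x ∈ C, x i₀ = b i₀ := by
  obtain ⟨C, hC, hconn, himg⟩ := exists_isConnected_fixedPoints hab i₀ hf hmaps hpar
  have ha : a i₀ ∈ (fun x : ι → ℝ => x i₀) '' C := by
    rw [himg]; exact Set.left_mem_Icc.2 (hab i₀)
  have hb : b i₀ ∈ (fun x : ι → ℝ => x i₀) '' C := by
    rw [himg]; exact Set.right_mem_Icc.2 (hab i₀)
  obtain ⟨x, hx, hxa⟩ := ha
  obtain ⟨y, hy, hyb⟩ := hb
  exact ⟨C, hC, hconn, ⟨x, hx, hxa⟩, y, hy, hyb⟩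

/-- **Existence at every parameter** (the slice-wise Brouwer theorem recovered from Browder's):
under the same hypotheses, for every `t ∈ [a_{i₀}, b_{i₀}]` the connected set of fixed points
contains a point with `x_{i₀} = t`. [cite: SolanSolan2023, Theorem 1.1] -/
theorem exists_isConnected_fixedPoints_forall {a b : ι → ℝ} (hab : a ≤ b) (i₀ : ι)
    {f : (ι → ℝ) → (ι → ℝ)} (hf : Continuous f) (hmaps : ∀ x, a ≤ x → x ≤ b → a ≤ f x ∧ f x ≤ b)
    (hpar : ∀ x, f x i₀ = x i₀) :
    ∃ C ⊆ {x | a ≤ x ∧ x ≤ b ∧ f x = x}, IsConnected C ∧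
      ∀ t ∈ Set.Icc (a i₀) (b i₀), ∃ x ∈ C, x i₀ = t := by
  obtain ⟨C, hC, hconn, himg⟩ := exists_isConnected_fixedPoints hab i₀ hf hmaps hpar
  refine ⟨C, hC, hconn, fun t ht => ?_⟩
  rw [← himg] at ht
  obtain ⟨x, hx, rfl⟩ := ht
  exact ⟨x, hx, rfl⟩

end Browder

end Literature.Topology.Euclidean.Browder
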